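/-
Origin: expansion seat `planner-pub-hodgecm-pv11-0`, handover 2026-08-18T03:56:51Z (`HOME/pub-hodgecm-pv11/lean/Pv11/N20.lean`, md5 dfd5c291, 154 lines);
landed by the gen-5 packager in gate run 20 as `HodgeCM/PerL34/N20.lean` (verbatim).
-/
/-
Copyright: pub-hodgecm cell, 2026-08-18.  Seat pv11 (planner-pub-hodgecm-pv11-0), DAG node N20 (Lemma 3.5, last
assertion) — verbatim form over the realisation interface, and its relation to `StubTree.thm44_of_realisation`.
-/
import Summits.HodgeConjecture.HodgeCM.StubTree.PerLProof

/-!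
# N20 — PerL v5 Lemma 3.5, last assertion (tex l. 353; proof ll. 375–378)

VERBATIM (l. 353): "Consequently, if `S_{12} \not\perp S_{34}` then `W^L_{per}(K)` holds."
Proof (ll. 375–378): "For the last assertion: if `⟨s,s′⟩ ≠ 0` with `s ∈ S₁₂`, `s′ ∈ S₃₄`, then by sesquilinearity
and continuity `⟨u₁∧u₂, u₃∧u₄⟩ ≠ 0` for some wedges as above, of a common neat level `K_f`; by Lemma 3.3(a),
`u_j ∈ U_{t^j}(S(K_f))`, so `Q(u₁,u₂,ū₃,ū₄) ≠ 0` (§3.1) and Lemma 3.1 applies."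

LEMMAS.md row N20 marks the node "PROVED over the interface: `StubTree.thm44_of_realisation`".  That theorem is the
SPECIALISATION of N20 which Theorem 4.4 uses (`s = s′ =` the non-zero line-field wedge of Prop 4.3, in
`S₁₂ = S₃₄` by Thm 3.7), and accordingly the interface `ThetaRealisation` carries Lemma 3.5 (i) asymmetrically
(`gen12` = (wedge ⊆ S) on the (12) side, `real34` = (gen ⊆ closed wedge span) on the (34) side).  This file
* types N20 VERBATIM for the given `(V₃,h)` (`N20_statement`: `S₁₂ ⊥̸ S₃₄ → PeriodNV`, the conclusion being
  `W^L_per(K)` realised on this very `(V₃,h)`, as Lemma 3.1 delivers it), with Lemma 3.5 (i) for BOTH sides in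
  closure form as the hypotheses PerL's proof uses (`ClosureForm R 0 1` for `S₁₂`, `ClosureForm R 2 3` for `S₃₄`);
* KERNEL-PROVES it (`N20_holds`) by exactly the four moves of ll. 375–378: sesquilinearity + continuity (twice:
  `StubTree.exists_inner_ne_zero_of_mem_closure_span`), common neat level (`level_inf`, `cover`, `Λ_cover`,
  pull-back stability of `U_Ψ` = model fact `pull_comp`), Lemma 3.3(a) (`Theta_sub`), `Q = ⟨·,·⟩` on holomorphic
  forms (`inner_Λ`, `U_Ψ ⊆ H^{1,0}` = model fact `pull_hodge`) and Lemma 3.1 (`periodNV_of_period_ne_zero`, node N08);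
* PROVES that the (34)-side closure form IS available on the interface (`closureForm34` from `S12_def` + `real34` +
  `H_chars34`), and re-derives Theorem 4.4 as N20 applied to `s = s′ =` the line-field wedge (`thm44_via_N20`),
  certifying that the package's proof of Thm 4.4 is N20 ∘ (Prop 4.3, Thm 3.7) and nothing else.
No new inputs; uses of `ModelAxioms`: `pull_comp`, `pull_hodge` (as `thm44_of_realisation`).
-/

set_option autoImplicit false

noncomputable section

open scoped InnerProductSpace

namespace HodgeCM.PerL34.N20

open HodgeCM HodgeCM.Universe HodgeCM.StubTree
open Literature.AlgebraicGeometry.Motives (CMType)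

variable {U : Universe} {L : CMField} {ι₁ : L →+* ℂ} {V : HermSpace3 L ι₁} {K : CMField}
  {Ψ : Fin 4 → CMType K} {σ : K →+* ℂ}

/-- The wedge-functions `u_k ∧ u_l` of theta one-forms of types `(Ψ_k, Ψ_l)` over ALL levels, as `L²` functions
on `[G_U]` (tex l. 350–352 "the wedges `u₁∧u₂` (viewed as scalar functions, §3.1) with `u_j` holomorphic
`1`-forms attached to vectors of `π_j[𝔭₊]`"). -/
def wedgeSet (R : U.ThetaRealisation ι₁ V K Ψ σ) (k l : Fin 4) : Set R.HG :=
  {x | ∃ Γ : Level V, ∃ ω ∈ R.Theta k Γ, ∃ ω' ∈ R.Theta l Γ, x = R.Λ Γ ω ω'}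

/-- Lemma 3.5 (i) for a side, in the closure form PerL's last assertion consumes: the closed subspace `S` of the
side lies in the closed span of that side's wedges. -/
def ClosureForm (R : U.ThetaRealisation ι₁ V K Ψ σ) (S : Submodule ℂ R.HG) (k l : Fin 4) : Prop :=
  (S : Set R.HG) ⊆ (Submodule.span ℂ (wedgeSet R k l)).topologicalClosure

/-- `S₁₂ ⊥̸ S₃₄` (tex l. 353, 375). -/
def NotOrthogonal (R : U.ThetaRealisation ι₁ V K Ψ σ) : Prop :=
  ∃ s ∈ R.S.t12.S12, ∃ s' ∈ R.S.t34.S12, ⟪s', s⟫_ℂ ≠ 0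

/-- **N20 verbatim** for the given `(V₃,h)`: "if `S₁₂ ⊥̸ S₃₄` then `W^L_per(K)` holds" — with `W^L_per(K)`
witnessed on this `(V₃,h)` (`PeriodNV`), which is what Lemma 3.1 produces. -/
def N20_statement (R : U.ThetaRealisation ι₁ V K Ψ σ) : Prop :=
  NotOrthogonal R → U.PeriodNV ι₁ V K Ψ σ

/-- The proof of ll. 375–378 for two given vectors `s ∈ \overline{span} W₁₂`, `s′ ∈ \overline{span} W₃₄` with
`⟨s′, s⟩ ≠ 0`. -/
theorem periodNV_of_inner_ne_zero (M : U.ModelAxioms) (R : U.ThetaRealisation ι₁ V K Ψ σ) {s s' : R.HG}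
    (hs : s ∈ (Submodule.span ℂ (wedgeSet R 0 1)).topologicalClosure)
    (hs' : s' ∈ (Submodule.span ℂ (wedgeSet R 2 3)).topologicalClosure) (hss' : ⟪s', s⟫_ℂ ≠ 0) :
    U.PeriodNV ι₁ V K Ψ σ := by
  classical
  -- sesquilinearity + continuity, (12) side: some wedge u₁∧u₂ at a level Γ₁ pairs non-trivially with s′
  obtain ⟨w, ⟨Γ₁, ω₁, hω₁, ω₂, hω₂, rfl⟩, hw⟩ := exists_inner_ne_zero_of_mem_closure_span hss' hs
  -- sesquilinearity + continuity, (34) side: some wedge u₃∧u₄ at a level Γ₂ pairs non-trivially with u₁∧u₂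
  have hw' : ⟪R.Λ Γ₁ ω₁ ω₂, s'⟫_ℂ ≠ 0 := by
    intro h0; apply hw; rw [← inner_conj_symm, h0, map_zero]
  obtain ⟨w', ⟨Γ₂, ω₃, hω₃, ω₄, hω₄, rfl⟩, hu⟩ := exists_inner_ne_zero_of_mem_closure_span hw' hs'
  -- common neat level
  obtain ⟨Γ, hΓ₁, hΓ₂⟩ := R.level_inf Γ₁ Γ₂
  let ω : Fin 4 → U.CohC (U.pms L ι₁ V Γ) 1 := fun i => match i with
    | 0 => U.pullC (R.cover Γ₁ Γ hΓ₁) 1 ω₁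
    | 1 => U.pullC (R.cover Γ₁ Γ hΓ₁) 1 ω₂
    | 2 => U.pullC (R.cover Γ₂ Γ hΓ₂) 1 ω₃
    | 3 => U.pullC (R.cover Γ₂ Γ hΓ₂) 1 ω₄
  -- Lemma 3.3(a): `u_j ∈ U_{t^j}(S(K_f))` (pull-back stable)
  have hU : ∀ i, ω i ∈ U.Uiso Γ K (Ψ i) σ := by
    intro i
    match i with
    | 0 => exact Universe.pullC_mem_Uiso M.pull_comp _ K (Ψ 0) σ (R.Theta_sub 0 Γ₁ hω₁)
    | 1 => exact Universe.pullC_mem_Uiso M.pull_comp _ K (Ψ 1) σ (R.Theta_sub 1 Γ₁ hω₂)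
    | 2 => exact Universe.pullC_mem_Uiso M.pull_comp _ K (Ψ 2) σ (R.Theta_sub 2 Γ₂ hω₃)
    | 3 => exact Universe.pullC_mem_Uiso M.pull_comp _ K (Ψ 3) σ (R.Theta_sub 3 Γ₂ hω₄)
  have hinner : ⟪R.Λ Γ (ω 2) (ω 3), R.Λ Γ (ω 0) (ω 1)⟫_ℂ ≠ 0 := by
    have e12 : R.Λ Γ (ω 0) (ω 1) = R.Λ Γ₁ ω₁ ω₂ := R.Λ_cover Γ₁ Γ hΓ₁ ω₁ ω₂
    have e34 : R.Λ Γ (ω 2) (ω 3) = R.Λ Γ₂ ω₃ ω₄ := R.Λ_cover Γ₂ Γ hΓ₂ ω₃ ω₄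
    rw [e12, e34]
    intro h0; apply hu; rw [← inner_conj_symm, h0, map_zero]
  -- `Q(u₁,u₂,ū₃,ū₄) = ⟨u₁∧u₂, u₃∧u₄⟩ ≠ 0` (§3.1: all four are holomorphic one-forms)
  obtain ⟨c, -, hcΛ⟩ := R.inner_Λ Γ
  have hper : U.period (U.pms L ι₁ V Γ) ω ≠ 0 := by
    have h := hcΛ ω (fun i => Universe.Uiso_le_H10 M.pull_hodge Γ K (Ψ i) σ (hU i))
    intro h0
    rw [h0, mul_zero] at h
    exact hinner h
  -- Lemma 3.1 (node N08)
  exact Universe.periodNV_of_period_ne_zero Γ ω hU hper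

/-- **N20 holds** (KERNEL-PROVED over the interface) given Lemma 3.5 (i) for both sides in closure form. -/
theorem N20_holds (M : U.ModelAxioms) (R : U.ThetaRealisation ι₁ V K Ψ σ) (h12 : ClosureForm R R.S.t12.S12 0 1)
    (h34 : ClosureForm R R.S.t34.S12 2 3) : N20_statement R := by
  rintro ⟨s, hs, s', hs', hss'⟩
  exact periodNV_of_inner_ne_zero M R (h12 hs) (h34 hs') hss'

/-- The (34)-side closure form IS carried by the interface: `S₃₄ = \overline{span}` of the generators
`ϑ_{T′,χ}(Φ)` (`S12_def`), every `χ` is allowed (`H_chars34`, node N31) and every generator lies in the closed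
wedge span (`real34`, node N19). -/
theorem closureForm34 (R : U.ThetaRealisation ι₁ V K Ψ σ) : ClosureForm R R.S.t34.S12 2 3 := by
  intro s hs
  have hle : R.S.t34.S12 ≤ (Submodule.span ℂ (wedgeSet R 2 3)).topologicalClosure := by
    rw [R.S.t34.S12_def]
    refine Submodule.topologicalClosure_minimal _ (Submodule.span_le.mpr ?_) (Submodule.isClosed_topologicalClosure _)
    rintro u ⟨χ, hχ, Φ, rfl⟩
    exact R.real34 χ hχ Φ
  exact hle hs

/-- A single wedge of the (12) side lies in the closed (12)-wedge span (the only instance of the (12)-side closure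
form that Theorem 4.4 needs). -/
theorem wedge_mem_closure12 (R : U.ThetaRealisation ι₁ V K Ψ σ) (Γ : Level V)
    {ω₁ ω₂ : U.CohC (U.pms L ι₁ V Γ) 1} (hω₁ : ω₁ ∈ R.Theta 0 Γ) (hω₂ : ω₂ ∈ R.Theta 1 Γ) :
    R.Λ Γ ω₁ ω₂ ∈ (Submodule.span ℂ (wedgeSet R 0 1)).topologicalClosure :=
  (Submodule.le_topologicalClosure _) (Submodule.subset_span ⟨Γ, ω₁, hω₁, ω₂, hω₂, rfl⟩)

/-- `S₁₂ ⊥̸ S₃₄` from Prop 4.3 (non-zero line-field wedge in `S₁₂`) and Thm 3.7 (`S₁₂ = S₃₄`): take `s = s′`. -/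
theorem notOrthogonal (R : U.ThetaRealisation ι₁ V K Ψ σ) : NotOrthogonal R := by
  obtain ⟨Γ, ω₁, hω₁, ω₂, hω₂, hv⟩ := R.lineField
  refine ⟨R.Λ Γ ω₁ ω₂, R.gen12 Γ ω₁ ω₂ hω₁ hω₂, R.Λ Γ ω₁ ω₂, ?_, inner_self_ne_zero.mpr hv⟩
  rw [← R.S.C2_S12_eq_S34]
  exact R.gen12 Γ ω₁ ω₂ hω₁ hω₂

/-- **Theorem 4.4 re-derived as N20 ∘ (Prop 4.3, Thm 3.7)** — the same statement as
`StubTree.thm44_of_realisation`, obtained by feeding the line-field wedge `v` (as both `s` and `s′`) to the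
verbatim N20 argument; certifies that the package's asymmetric interface (`gen12`, `real34`) is exactly what N20's
proof consumes in that application. -/
theorem thm44_via_N20 (M : U.ModelAxioms) (R : U.ThetaRealisation ι₁ V K Ψ σ) : U.PeriodNV ι₁ V K Ψ σ := by
  obtain ⟨Γ, ω₁, hω₁, ω₂, hω₂, hv⟩ := R.lineField
  have h34 : R.Λ Γ ω₁ ω₂ ∈ R.S.t34.S12 := by
    rw [← R.S.C2_S12_eq_S34]; exact R.gen12 Γ ω₁ ω₂ hω₁ hω₂
  exact periodNV_of_inner_ne_zero M R (wedge_mem_closure12 R Γ hω₁ hω₂) (closureForm34 R h34)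
    (inner_self_ne_zero.mpr hv)

end HodgeCM.PerL34.N20

end
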